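import Mathlib
import HarnessLib
import HarnessLib.Audit
import Summits.Schanuel.Statement
import HarnessLib.Audit.Status.Attr

/-!
Route: GeodesicRealLogs

DORMANT since 2026-08-24T09:47:18Z (reconciler: no traction for 6.7 d (last activity item-evidence-added at 2026-08-17T16:55:59Z); parked, not closed — `ledger route dormant route-Schanuel-GeodesicRealLogs --off` to reactivate) — unstaffed, not closed; items shared with open routes are served there. `ledger route dormant <id> --off` reactivates.

# Route GeodesicRealLogs — Schanuel = real-log sector (what hearing an arithmetic drum costs) + the
rest; first cells GP₃ and log-lattices

It suffices to show X = RealLogSector ∧ OffRealLogSector. RealLogSector: ℚ-linearly independent REAL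
numbers l₁…lₙ with
e^{lᵢ} algebraic (logarithms of positive real algebraic numbers, 𝓛_ℝ = 𝓛 ∩ ℝ) are algebraically
independent over ℚ — read off the
page, this is exactly and only what Prasad–Rapinchuk's conditional theorems on length-commensurable
ARITHMETIC locally symmetric spaces
use of Schanuel (arXiv:1110.0141 Prop 7.1 with d = 0: SC is applied to A ∪ B ⊂ ℝ, logs of values of
positive characters).
OffRealLogSector: Schanuel RELATIVE to K₀ = ℚ(𝓛_ℝ): for x₁…xₙ ∈ ℂ ℚ-linearly independent modulo
span_ℚ 𝓛_ℝ,
trdeg_{K₀} K₀(x, eˣ) ≥ n. The split is exact (Schanuel ⟺ X; both directions elementary and filed)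
and realises card
geodesic-lengths-pdq-gp3-v2: its degree-2 cells of RealLogSector — RealGP3 (no three independent
real logs in geometric progression,
= PDQ21 on ℚ-isotropic classes by Hasse–Minkowski), AnisotropicPDQ21, and FlatLatticeLogs (no flat
2-torus has all closed-geodesic
lengths in 𝓛_ℝ; the flats amplification) — are the first ranked cruxes, strictly inside
RealLogSector.
Lean: `(∀ (n : ℕ) (l : Fin n → ℝ), (∀ i, IsAlgebraic ℚ (Real.exp (l i))) → LinearIndependent ℚ l →
AlgebraicIndependent ℚ l) ∧ (∀ (n : ℕ) (x : Fin n → ℂ), LinearIndependent ℚ ((Submodule.span ℚ {z :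
ℂ | z.im = 0 ∧ IsAlgebraic ℚ (Complex.exp z)}).mkQ ∘ x) → (n : Cardinal) ≤ Algebra.trdeg
↥(IntermediateField.adjoin ℚ {z : ℂ | z.im = 0 ∧ IsAlgebraic ℚ (Complex.exp z)})
↥(IntermediateField.adjoin ↥(IntermediateField.adjoin ℚ {z : ℂ | z.im = 0 ∧ IsAlgebraic ℚ
(Complex.exp z)}) (Set.range x ∪ Set.range (Complex.exp ∘ x))))`

## Assembly
Elementary but real Lean work (Mathlib's `Algebra.trdeg` over `IntermediateField.adjoin`; the
𝓛-version is route LogPatterns' open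
assembly item, same proof): 𝓛_ℝ is a ℚ-subspace of ℂ (e^{x+y} = eˣeʸ, e^{x/q} = the positive real
q-th root); given z ∈ ℂⁿ ℚ-linearly
independent choose P ∈ GL_n(ℚ) with Pz = (w, z′), w a basis of span_ℚ z ∩ 𝓛_ℝ (k entries, real with
algebraic exponentials) and z′
independent modulo 𝓛_ℝ (n − k entries); trdeg ℚ(z, e^z) = trdeg ℚ(Pz, e^{Pz}) (both algebraic over
each other via e^{z/N}); trdeg_ℚ
ℚ(w, e^w) = trdeg_ℚ ℚ(w) = k by RealLogSector; over ℚ(w, e^w) ⊂ K₀(e^w) (algebraic over K₀) the rest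
has trdeg ≥ trdeg_{K₀} K₀(z′,
e^{z′}) ≥ n − k by OffRealLogSector; the tower law adds up to n. The deciding theorem `closes (hR :
RealLogSector) (hO :
OffRealLogSector) (hA : Assembly) : Schanuel := hA hR hO` is certified in glue.lean.

Rationale: WHY THIS LINE. Mechanism (card geodesic-lengths-pdq-gp3-v2, v1 route GeodesicLengthsGP3 retired
not-a-thesis because its assembly stopped at the sector
target): cut Schanuel at the ℚ-subspace 𝓛_ℝ of real logarithms of algebraic numbers — a
GL_n(ℚ)-adapted basis of span z ∩ 𝓛_ℝ plus the
tower law gives Schanuel ⟺ RealLogSector ∧ OffRealLogSector (the 𝓛_ℝ-analogue of Kirby's ecl(∅)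
localisation, Kirby2010EAEF Thm 1.2,
and of route LogPatterns' split at 𝓛) — so that the transcendence input of a theorem in DIFFERENTIAL
GEOMETRY (PrasadRapinchuk2013 =
arXiv:1110.0141 Thm 1–5, Prop 7.1; doi:10.1007/s10240-009-0019-6 §8; arXiv:1307.1479 §6: λ_Γ(γ)² = Σ
s_k (log χ_k(γ))², a
positive-definite rational quadratic form in ℚ-independent real logs) is a NAMED HYPOTHESIS of the
deciding theorem rather than "Schanuel".
Inside RealLogSector the card's arithmetic of quadratic forms ranks the first open cells: at rank
(2,1) the geometric statement needs
PDQ21 (x² + Dw² ≠ Cz² on independent real logs), which Hasse–Minkowski splits into RealGP3 on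
ℚ-isotropic classes (secant
parametrisation: the real symmetric case [[λ₀,λ₁],[λ₁,λ₂]] of the four exponentials conjecture on
Roy's no-go surface xy = z², Roy1995
§3.2) and a strong-four-exponentials instance on anisotropic classes (Waldschmidt2005 Conj 1.5),
while compact 2-flats
(Prasad–Raghunathan, doi:10.2307/1970790) amplify length-commensurability to a whole log-lattice
{μ|m+nτ|} ⊂ 𝓛_ℝ — infinitely many
quadratic relations on three parameters, the only regime (GP₄ vs GP₃) where six-exponentials
technology has beaten a single quadratic
relation. What is a theorem rides as support: algebraic ratios (Gelfond1934, tree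
gelfond_schneider_holds), length 4 (six exponentials,
tree six_exponentials_holds), CM lattices, and the calibrations Schanuel ⇒ each crux. Imports:
arithmetic groups / symmetric spaces
(length formula, flats), quadratic forms over ℚ (isotropy, Hilbert symbols), transcendence (four/six
exponentials, Roy's structural
picture). What no prior route does: LogPatterns splits at 𝓛 and maps incidence patterns; no open
route has a consumer, a real-sector
hypothesis, or a degree-2 statement on real logs; the negatives index is empty.

RANKED CRUXES. #2 RealGP3 (crux) — no three ℚ-linearly independent real logarithms of (positive
real) algebraic numbers are in geometric progression: x₁² ≠ x₀x₂ (card C1; equivalently PDQ21 on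
every ℚ-isotropic class, e.g. no Pythagorean triple of independent real logs). The symmetric
rank-one case of the four exponentials conjecture restricted to real points; algebraic ratio
excluded by Gelfond–Schneider, length 4 by six exponentials (supports). [difficulty: open-problem]
(why it might fail: the real symmetric case [[λ₀,λ₁],[λ₁,λ₂]] of the four exponentials conjecture on
Roy's no-go surface xy = z² (Roy1995 Thm 3.4): no method known, reality gives no leverage (Diaz's
conjugation results void); false iff (log β)² = (log α)(log γ), α, β, γ multiplicatively independent
real algebraic.) [Roy1995, Waldschmidt2005, Waldschmidt2000, doi:10.5486/pmd.2007.3505,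
doi:10.1007/s11139-015-9728-2]
#3 FlatLatticeLogs (crux) — for every scale μ > 0 and every τ in the upper half plane some lattice
length μ|m + nτ| ((m,n) ∈ ℤ²) is not the logarithm of an algebraic number: no flat 2-torus has all
its closed-geodesic lengths in 𝓛_ℝ (card C2 'Q3C', flat form: via a compact 2-flat of a rank-2
arithmetic quotient this alone forbids length-commensurability with a space whose lengths are
rational multiples of single logs). CM lattices fall to Gelfond–Schneider (support FlatLatticeCM);
RealLogSector ⇒ it from five lengths (support FragmentOfRealLogSector). [difficulty: L] (why it
might fail: every finite set of lengths obeys only diagonal quadratic relations (parallelogram law),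
each a 2×2 rank-one log matrix — four-exponentials-hard one at a time; nothing in print consumes
infinitely many such relations; only CM lattices fall.) [doi:10.2307/1970790, arXiv:1110.0141,
Waldschmidt2005, Roy1995]
#4 AnisotropicPDQ21 (crux) — PDQ21 on the ℚ-ANISOTROPIC classes: if X² + D W² − C Z² (D, C ∈ ℚ_{>0})
has no nontrivial rational zero, it has no zero (x, w, z) made of ℚ-linearly independent real
logarithms of algebraic numbers (card (2), anisotropic branch; the v1 planner's Hilbert-symbol
computation, to be re-grounded, puts the basic pairs A₂|B₂|G₂ vs A₁ in classes ⟨1,3,−2⟩, ⟨1,1,−3⟩,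
⟨6,2,−1⟩, all anisotropic at p = 3). [deps: RealGP3] [difficulty: open-problem] (why it might fail:
over ℚ(√C) the conic parametrises into a GP₃ inside 𝓛 + √C·𝓛 ⊂ 𝓛̃, a case of the STRONG four
exponentials conjecture (Waldschmidt2005 Conj 1.5) on Roy's no-go surface — beyond even RealGP3; no
partial result for real entries.) [Waldschmidt2005, Roy1995, arXiv:1110.0141,
doi:10.3792/pjaa.71.151]
#5 RealLogSector (crux) — algebraic independence of REAL logarithms: ℚ-linearly independent real
numbers l₁…lₙ with e^{lᵢ} algebraic are algebraically independent over ℚ — the conjecture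
AlgIndepLogarithms restricted to 𝓛_ℝ = 𝓛 ∩ ℝ, verbatim the transcendence input of Prasad–Rapinchuk's
Prop 7.1 for arithmetic groups (d = 0). Contains RealGP3, AnisotropicPDQ21, FlatLatticeLogs (support
FragmentOfRealLogSector); implied by Schanuel (support RealLogSectorOfSchanuel). [deps: RealGP3,
AnisotropicPDQ21, FlatLatticeLogs] [difficulty: open-problem] (why it might fail: open for every n ≥
2 — log 2, log 3 are not known algebraically independent; Baker gives degree 1 only and the linear
subgroup theorem only rank ≥ structural rank/2 (Roy1995 Cor 1.3); reality removes even Diaz's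
conjugation tricks. False iff Schanuel fails on real logs.) [Waldschmidt2000, Roy1995, Roy1992,
BakerTNT1975, PrasadRapinchuk2013]
#6 OffRealLogSector (crux) — Schanuel relative to K₀ = ℚ(𝓛_ℝ), 𝓛_ℝ = {z ∈ ℂ : Im z = 0, e^z ∈ ℚ̄}:
if x₁…xₙ ∈ ℂ are ℚ-linearly independent modulo the ℚ-span of 𝓛_ℝ, then trdeg over K₀ of K₀(x, eˣ) is
≥ n. The complement of the real-log sector (x = (iπ): π is transcendental over ℚ(log 2, log 3, …); x
= (1): e is); Schanuel ⇒ it (support OffRealLogSectorOfSchanuel) and RealLogSector ∧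
OffRealLogSector ⇒ Schanuel (Assembly). [difficulty: open-problem] (why it might fail: it is most of
Schanuel (already n = 1 contains 'log 2 and π algebraically independent' and 'e ∉ ℚ(𝓛_ℝ)‾', both
open); 'independent mod 𝓛_ℝ' is undecided in examples; no transcendence method works relative to the
infinitely generated base ℚ(𝓛_ℝ).) [Kirby2010EAEF, Waldschmidt2000, BakerTNT1975]
#9 IsotropicReduction (support) — RealGP3 ⇒ PDQ21 on every ℚ-isotropic class: a nontrivial rational
zero (a, b, c) of X² + DW² − CZ² (D, C > 0) has c ≠ 0; the secant parametrisation from (a/c, b/c)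
writes every real zero as ν·M·(t², t, 1)ᵀ with M ∈ M₃(ℚ), det M = −4DC ≠ 0, so a zero with
ℚ-independent coordinates in 𝓛_ℝ yields the progression (ν, νt, νt²) ∈ 𝓛_ℝ³, ℚ-independent. Explicit
algebra, ~300 lines. [difficulty: provable-now] [arXiv:1110.0141, Roy1995]
#9 PythagoreanIffGP3 (support) — 'no Pythagorean triple of ℚ-independent real logs of algebraic
numbers' ⟺ RealGP3: (y₂ − y₀, 2y₁, y₂ + y₀) ↔ (y₀, y₁, y₂) is an invertible rational change of
variables between the cones x² + w² = z² and y₁² = y₀y₂ preserving 𝓛_ℝ³ and ℚ-independence.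
[difficulty: provable-now] [Roy1995]
#9 GP4 (support) — no four ℚ-linearly independent logarithms of algebraic numbers in geometric
progression (card T1): with s = x₁/x₀ apply the six exponentials theorem (tree theorem
Literature.NumberTheory.Transcendental.six_exponentials_holds) to (x₀, x₀s) × (1, s, s²), whose six
exponentials are e^{x₀}, e^{x₁}, e^{x₂}, e^{x₁}, e^{x₂}, e^{x₃}; 1, s, s² are ℚ-independent because
s is transcendental (RatioTranscendental) — or directly from the independence of x. [difficulty:
provable-now] [Waldschmidt2005, Lang1966]
#9 RatioTranscendental (support) — the ratio of two ℚ-independent logarithms of algebraic numbers is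
transcendental (so every GP₃ of logs has transcendental ratio, card (3)(i)): Gelfond–Schneider (tree
theorem gelfond_schneider_holds) with a = e^{x₀}, b = x₁/x₀. [difficulty: provable-now]
[Gelfond1934, Waldschmidt2000]
#9 FlatLatticeCM (support) — FlatLatticeLogs for CM lattices (Re τ and |τ|² rational): μ = length of
(1,0) ∈ 𝓛_ℝ, |m+nτ|² = f(m,n) a positive-definite RATIONAL binary form with f(1,0) = 1; f takes a
non-square rational value on ℤ² (a rational quadratic polynomial all of whose integer values are
rational squares is the square of a linear one, impossible as disc f < 0), and then μ√f ∈ 𝓛_ℝ with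
√f real algebraic irrational contradicts Gelfond–Schneider (gelfond_schneider_holds). [difficulty:
provable-now] [Gelfond1934, doi:10.2307/1970790]
#9 FragmentOfRealLogSector (support) — calibration — the degree-2 cells lie inside RealLogSector:
RealLogSector ⇒ PDQ21 on all classes (X₀² + D X₁² − C X₂² is a nonzero polynomial) ∧ FlatLatticeLogs
(five lengths k ∈ {(1,0),(0,1),(1,1),(1,−1),(1,2)}: if |τ| ∉ ℚ the identities P² + Q² = 2A² + 2C²,
R² = A² + P² − Q² + 4C² among linear forms in an algebraically independent basis force P = ±A ± C,
i.e. |1+τ| = 1+|τ| or |1−|τ||, so τ ∈ ℝ; if |τ| ∈ ℚ, Re τ ∉ ℚ the first identity alone is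
contradictory; if Re τ, |τ|² ∈ ℚ it is the CM case, where Gelfond–Schneider for real exponents
follows from RealLogSector itself). Planner's derivation in NOTES.md; ~500 lines. [difficulty: M]
[Waldschmidt2005, arXiv:1110.0141, doi:10.2307/1970790]
#9 RealLogSectorOfSchanuel (support) — calibration — Schanuel ⇒ RealLogSector: tree theorem
Literature.Barriers.Schanuel.algIndepLogarithms_of_schanuel (Schanuel ⇒ algebraic independence of
complex logs) transported along the injective ℚ-algebra map ℝ → ℂ (Complex.ofReal_exp,
LinearIndependent and AlgebraicIndependent.of_comp). ~100 lines. [difficulty: provable-now]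
[Roy1992, Waldschmidt2000]
#9 OffRealLogSectorOfSchanuel (support) — exactness of the split — Schanuel ⇒ OffRealLogSector: a
transcendence basis of K₀(x, eˣ)/K₀ inside {x, eˣ} and the algebraicity of the 2n generators over it
involve finitely many real logarithms; take a ℚ-basis l ⊂ 𝓛_ℝ of their span; (l, x) is ℚ-independent
because x is independent mod span 𝓛_ℝ; Schanuel for (l, x), e^l algebraic and trdeg ℚ(l) ≤ |l| give
trdeg_{ℚ(l)} ℚ(l)(x, eˣ) ≥ n, contradicting a smaller transcendence degree over K₀ ⊇ ℚ(l).
[difficulty: provable-now] [Kirby2010EAEF, Waldschmidt2000]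

TWO-LAYER PLAN. Foreseen glued splits (none filed now): OffRealLogSector ⇐ ArgumentsOverModuli
(algebraic independence of logs relative to ℚ(𝓛_ℝ):
l ∈ 𝓛ⁿ independent mod 𝓛_ℝ ⇒ trdeg_{ℚ(𝓛_ℝ)} ≥ n — 'arguments of algebraic numbers over their
moduli') → OffLogSector [verbatim route
LogPatterns' stmt-Schanuel-4311, shared by signature] → OffRealLogSector (k = 2, same GL_n(ℚ) glue
one level down), filed when either
neighbour moves; FlatLatticeLogs ⇐ FlatLatticeNonCM → FlatLatticeCM → FlatLatticeLogs (k = 2; the CM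
child is already a support);
RealGP3 ⇐ [ratio ∈ 𝓛̃: strong six exponentials, Roy1992 / Waldschmidt2005 Cor 2.4, once that named
fact is a tree theorem] → [ratio ∉ 𝓛̃:
the residue] → RealGP3; AnisotropicPDQ21 ⇐ per real quadratic field ℚ(√C) only if a class-specific
tool appears; RealLogSector ⇐
its degree-2 layer PDQ(a,b) (all ranks: two positive-definite rational forms never agree on jointly
independent real logs — the full
pointwise input of the (N_i) statements) → degree ≥ 3 — only if a method consuming one quadratic
relation appears.

KILL CRITERIA. Every crux is implied by Schanuel through filed supports (RealLogSectorOfSchanuel,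
FragmentOfRealLogSector with IsotropicReduction,
OffRealLogSectorOfSchanuel), so ¬RealGP3 (three independent real logs in geometric progression),
¬AnisotropicPDQ21, ¬FlatLatticeLogs (a
log-lattice), ¬RealLogSector or ¬OffRealLogSector each closes the route `refuted:<Decl>` AND refutes
Schanuel — hand the witness to the
summit's negative side (every Schanuel route dies). Proved elsewhere: FourExponentialsConjecture ⇒
RealGP3 in ten lines (demote to
support); strong four exponentials ⇒ AnisotropicPDQ21; AlgIndepLogarithms (route LogPatterns'
LogSector) ⇒ RealLogSector outright — then
this route's real sector is absorbed and only OffRealLogSector/Assembly remain, shared with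
LogPatterns via the foreseen split (close
superseded if nothing distinct is left). FragmentOfRealLogSector refuted (my five-length derivation
wrong) ⇒ misstated support, repaired
with more lattice vectors; no crux moves. A grounder finding PDQ21 / real GP₃ / log-lattices in
print (Roy–Waldschmidt 1995
doi:10.3792/pjaa.71.151, acq-02353; Diaz2008) drops the novelty grade, not the route.

NOT DECOMPOSED YET. The geometric corollary itself ('a compact arithmetic quotient of real rank 2 is
not length-commensurable to an arithmetic hyperbolic
surface', conditional only on PDQ21 or on FlatLatticeLogs) is not typable (no arithmetic lattices /
closed geodesics of locally symmetric
spaces in Lean) — a cite-fact request for P–R's length formula and Prop 7.1, not an item. Also left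
whole: PDQ(a,b) for higher ranks
and the quartic relations behind (N_i); the bounded-degree refinement of FlatLatticeLogs (lengths of
arithmetic manifolds are logs of
units of bounded degree — the card's Q3C proper); the complex GP₃ where Diaz-type conjugation gives
partial results; everything inside
OffRealLogSector (routes LogPatterns / RigidCore / AlgIndepMethod / DiophantineCore territory); Prop
7.1 with d > 0 (needs Schanuel for
real tuples, not just real logs).

CHEAPEST FALSIFIER. Lookup first: does Roy–Waldschmidt, Proc. Japan Acad. 71 (1995)
(doi:10.3792/pjaa.71.151, paywalled, acq-02353) or Diaz2008 already state
PDQ21 / real GP₃ / a lattice-of-logs statement or prove a case? (Expected: their unconditional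
results need ≥ 5 variables, Waldschmidt2005
Thm 2.11 needs l > m²; the ternary case is Roy's no-go.) Second (paper, an hour): re-derive
FragmentOfRealLogSector's five-length argument
(NOTES.md of this seat) and OffRealLogSectorOfSchanuel's finiteness argument — if either leaks, a
support is misstated, cruxes and
closes unaffected. Third: a refuter shows the finite truncations of FlatLatticeLogs reduce to single
2×2 rank-one log matrices only —
then crux 3 is not more attackable than crux 2 and is re-ranked. Done here: all 14 statements and
`closes` elaborate (Sketch.lean rc 0).

NUMBERS. Linear subgroup theorem window r(d+l) < dl: (2,2,1) fails 4 = 4 (four exponentials, open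
since Schneider/Lang/Ramachandra), (2,3,1)
holds 5 < 6 (six exponentials, tree theorem); Roy1995 Thm 3.4: 4r ≥ d + l for matrices over a
3-dimensional ⟨λ₁,λ₂,λ₃⟩_ℚ; structural
rank r ≤ s ≤ 2r (Roy1995 Cor 1.3). Geometric progressions of logs: length 4 impossible (theorem),
length 3 open, ratio transcendental
(Gelfond–Schneider). Geometry: hyperbolic 2- and 3-manifolds unconditional
(doi:10.1215/s0012-7094-92-06508-2,
doi:10.1215/00127094-2008-045: rank one needs only Gelfond–Schneider/Baker); every P–R statement in
real rank > 1 conditional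
(arXiv:1307.1479 §6); Prop 7.1 uses SC once, on A ∪ B ⊂ ℝ (arXiv:1110.0141 p. 24). Items at open: 14
(5 cruxes, 8 supports, 1 assembly).

DEFINITION REQUESTS. None for the items (all inline over Mathlib: IsAlgebraic ℚ (Real.exp x),
LinearIndependent ℚ, Algebra.trdeg, IntermediateField.adjoin,
‖m + nτ‖). Cite fact wanted later (not load-bearing for any item): 'Prasad–Rapinchuk length formula
λ_Γ(γ)² = Σ_k s_k (log χ_k(γ))² and
Prop 7.1 with SC replaced by RealLogSector for d = 0' (arXiv:1110.0141 §7;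
doi:10.1007/s10240-009-0019-6 Prop 8.5). Literature wanted:
doi:10.3792/pjaa.71.151 (acq-02353, filed by the v1 seat).

Novelty: Searches (2026-08-15, this seat): `lit search --hybrid "algebraic independence of real logarithms …
length commensurable … Schanuel"` (12
docs, vector leg only: Chudnovsky 1984, Baker (ed.) 1988, Nesterenko–Philippon 2001, Baker–Wüstholz
2007, Pila 2022 — none on real-log
sectors or length spectra); `lit search --source zbmath "weakly commensurable arithmetic groups
lengths closed geodesics Schanuel"` (2:
arXiv:0809.2401, arXiv:1110.0141); `lit search --source zbmath "quadratic relations logarithms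
algebraic numbers Roy Waldschmidt"` (1:
doi:10.3792/pjaa.71.151, not held); `lit search --source zbmath "Schanuel conjecture real numbers
restriction"` (1, o-minimality, irrelevant);
`lit galaxy search "length-commensurable" --star all` (2 pdf hits, both Prasad–Rapinchuk on
embeddings of fields with involution — not
transcendence); `lit galaxy search "logarithms of algebraic numbers in geometric progression" --star
all` (0); `lit galaxy search "strong
four exponentials conjecture" --star all` (1: Baker (ed.) 1988); `lit frontier Schanuel --since
2020` (30 rows: Zilber–Pink, p-adic,
elliptic Schanuel variations arXiv:2504.14048/14041 — nothing on length spectra or real sectors);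
`lit bridges Schanuel --cross any` (30,
none relevant); `lit read arXiv:1110.0141` pp. 23–24 (Prop 7.1 and proof: SC applied once, to A ∪ B
⊂ ℝ); `ledger negatives --problem
Schanuel` (0). Plus the card's and the v1 seat's searches of the same day (zbMATH "four exponentials
conjecture" 19–25 hits, P–R circle  [refs: 10.3792/pjaa.71.151, 0809.2401, 1110.0141, 2504.14048, 1307.1479, 2408.08178, doi:10.3792/pjaa.71.151, PrasadRapinchuk2013, Roy1995]

Barriers (technique_class: six-exponentials linear-subgroup-theorem sector-split): - technique_class: six-exponentials linear-subgroup-theorem sector-split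
- Literature.Barriers.Schanuel.LinearSubgroupMethodLimit: NOT evaded for RealGP3 / AnisotropicPDQ21
— they live on Roy's surface xy = z² (roy1995_thm_3_4_holds: every linear local embedding lands
outside the LST range); declared open-problem cruxes. FlatLatticeLogs changes the hypothesis class:
one point of 𝓛_ℝ^{ℤ²} on an infinite intersection of quadrics (3 parameters), whose finite
truncations are 3-folds in growing ambient dimension — the regime (like M_{2,l}(1), l ≥ 3) where LST
numerology can turn favourable; the bet is that some truncation admits a linear embedding in range,
or that lattice rigidity substitutes for it. It may not; then rank 3 is re-ranked below rank 2.
- Literature.Barriers.Schanuel.AlgebraicIndependenceOfLogarithms: not evaded — RealLogSector IS the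
barrier's conjecture restricted to real logs, and the degree-2 cruxes sit strictly below it; the
route states plainly that nothing here climbs from degree 2 to RealLogSector, and measures a
consumer's cost in these units.
- Literature.Barriers.Schanuel.LargeTranscendenceDegree: not applicable to the degree-2 cells
(non-vanishing of one quadratic form, no trdeg ≥ 2 output); it applies in full to OffRealLogSector
(trdeg ≥ n outputs relative to ℚ(𝓛_ℝ)) — conceded: that crux is 'the rest of Schanuel' and is left
whole.
- Literature.Barriers.Schanuel.PeriodConjectureOverQbarScope: RealLogSector and its cells are degree
≥ 2 statements about

Novelty grade: variant — route-review rreview-0815T18-7 (refuter): VARIANT/RECOMBINATION — the deciding theorem, Assembly and OffRealLogSector are route-Schanuel-LogPatterns' LogSector/OffLogSector/Assembly (LogPatterns.lean:285-372) with L={e^z alg} replaced by L_R = L cap R; every other item (RealGP3, FlatLatticeLogs, Ani (refuter refuter-rreview-0815T18-7-0, 2026-08-15T19:08:03Z; prior: route-Schanuel-LogPatterns, route-Schanuel-GeodesicLengthsGP3, arXiv:1110.0141, Roy1995, Waldschmidt2005)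

History (route lifecycle, newest last):
- 2026-08-24T09:47:18Z · DORMANT — reconciler: no traction for 6.7 d (last activity item-evidence-added at 2026-08-17T16:55:59Z); parked, not closed — `ledger route dormant route-Schanuel-Geodesi (operator:999:483846)

sub-problem: Schanuel · status: dormant · opened planner-plancard-Schanuel-Schanuel-geodesic-l-d32465ca-g2-0 2026-08-15T18:42:45Z · rev 1 · ledger route-Schanuel-GeodesicRealLogs
GENERATED by the gate from the ledger (D-0016/17). Provers cite these decls: `theorem foo : Summit.Schanuel.Schanuel.Theses.GeodesicRealLogs.<Decl> := …` in Summits/Schanuel/Schanuel/Theorems/<Name>.lean.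
-/

namespace Summit.Schanuel.Schanuel.Theses.GeodesicRealLogs

open scoped BigOperators Topology Manifold Classical MeasureTheory ProbabilityTheory Matrix InnerProductSpace ComplexConjugate ContinuousMap
open Filter Set Function TopologicalSpace MeasureTheory

attribute [summit_statement] _root_.Schanuel

open Literature.Periods

/-- item stmt-Schanuel-11764 · crux · rank 2 · open · by planner
why it might fail: the real symmetric case [[λ₀,λ₁],[λ₁,λ₂]] of the four exponentials conjecture on Roy's no-go surface xy = z² (Roy1995 Thm 3.4): no method known, reality gives no leverage (Diaz's conjugation results void); false iff (log β)² = (log α)(log γ), α, β, γ multiplicatively independent real algebraic.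
sources: Roy1995, Waldschmidt2005, Waldschmidt2000, doi:10.5486/pmd.2007.3505, doi:10.1007/s11139-015-9728-2
[crux] no three ℚ-linearly independent real logarithms of (positive real) algebraic numbers are in
geometric progression: x₁² ≠ x₀x₂ (card C1; equivalently PDQ21 on every ℚ-isotropic class, e.g. no
Pythagorean triple of independent real logs). The symmetric rank-one case of the four exponentials
conjecture restricted to real points; algebraic ratio excluded by Gelfond–Schneider, length 4 by six
exponentials (supports). [difficulty: open-problem] -/
@[route_item "route-Schanuel-GeodesicRealLogs"]
def RealGP3 : Prop :=
  ∀ x : Fin 3 → ℝ, LinearIndependent ℚ x → (∀ i, IsAlgebraic ℚ (Real.exp (x i))) → x 1 ^ 2 ≠ x 0 * x 2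

/-- item stmt-Schanuel-11765 · crux · rank 3 · open · by planner
why it might fail: every finite set of lengths obeys only diagonal quadratic relations (parallelogram law), each a 2×2 rank-one log matrix — four-exponentials-hard one at a time; nothing in print consumes infinitely many such relations; only CM lattices fall.
sources: doi:10.2307/1970790, arXiv:1110.0141, Waldschmidt2005, Roy1995
[crux] for every scale μ > 0 and every τ in the upper half plane some lattice length μ|m + nτ|
((m,n) ∈ ℤ²) is not the logarithm of an algebraic number: no flat 2-torus has all its
closed-geodesic lengths in 𝓛_ℝ (card C2 'Q3C', flat form: via a compact 2-flat of a rank-2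
arithmetic quotient this alone forbids length-commensurability with a space whose lengths are
rational multiples of single logs). CM lattices fall to Gelfond–Schneider (support FlatLatticeCM);
RealLogSector ⇒ it from five lengths (support FragmentOfRealLogSector). [difficulty: L] -/
@[route_item "route-Schanuel-GeodesicRealLogs"]
def FlatLatticeLogs : Prop :=
  ∀ (μ : ℝ) (τ : ℂ), 0 < μ → 0 < τ.im → ∃ m n : ℤ, ¬ IsAlgebraic ℚ (Real.exp (μ * ‖(m : ℂ) + (n : ℂ) * τ‖))

/-- item stmt-Schanuel-11766 · crux · rank 4 · open · by planner
why it might fail: over ℚ(√C) the conic parametrises into a GP₃ inside 𝓛 + √C·𝓛 ⊂ 𝓛̃, a case of the STRONG four exponentials conjecture (Waldschmidt2005 Conj 1.5) on Roy's no-go surface — beyond even RealGP3; no partial result for real entries.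
sources: Waldschmidt2005, Roy1995, arXiv:1110.0141, doi:10.3792/pjaa.71.151
[crux] PDQ21 on the ℚ-ANISOTROPIC classes: if X² + D W² − C Z² (D, C ∈ ℚ_{>0}) has no nontrivial
rational zero, it has no zero (x, w, z) made of ℚ-linearly independent real logarithms of algebraic
numbers (card (2), anisotropic branch; the v1 planner's Hilbert-symbol computation, to be
re-grounded, puts the basic pairs A₂|B₂|G₂ vs A₁ in classes ⟨1,3,−2⟩, ⟨1,1,−3⟩, ⟨6,2,−1⟩, all
anisotropic at p = 3). [deps: RealGP3] [difficulty: open-problem] -/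
@[route_item "route-Schanuel-GeodesicRealLogs"]
def AnisotropicPDQ21 : Prop :=
  ∀ (D C : ℚ), 0 < D → 0 < C → (∀ a b c : ℚ, a ^ 2 + D * b ^ 2 = C * c ^ 2 → a = 0 ∧ b = 0 ∧ c = 0) → ∀ x : Fin 3 → ℝ, LinearIndependent ℚ x → (∀ i, IsAlgebraic ℚ (Real.exp (x i))) → x 0 ^ 2 + (D : ℝ) * x 1 ^ 2 ≠ (C : ℝ) * x 2 ^ 2

/-- item stmt-Schanuel-11767 · crux · rank 5 · open · by planner
why it might fail: open for every n ≥ 2 — log 2, log 3 are not known algebraically independent; Baker gives degree 1 only and the linear subgroup theorem only rank ≥ structural rank/2 (Roy1995 Cor 1.3); reality removes even Diaz's conjugation tricks. False iff Schanuel fails on real logs.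
sources: Waldschmidt2000, Roy1995, Roy1992, BakerTNT1975, PrasadRapinchuk2013
[crux] algebraic independence of REAL logarithms: ℚ-linearly independent real numbers l₁…lₙ with
e^{lᵢ} algebraic are algebraically independent over ℚ — the conjecture AlgIndepLogarithms restricted
to 𝓛_ℝ = 𝓛 ∩ ℝ, verbatim the transcendence input of Prasad–Rapinchuk's Prop 7.1 for arithmetic
groups (d = 0). Contains RealGP3, AnisotropicPDQ21, FlatLatticeLogs (support
FragmentOfRealLogSector); implied by Schanuel (support RealLogSectorOfSchanuel). [deps: RealGP3,
AnisotropicPDQ21, FlatLatticeLogs] [difficulty: open-problem] -/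
@[route_item "route-Schanuel-GeodesicRealLogs", crux]
def RealLogSector : Prop :=
  ∀ (n : ℕ) (l : Fin n → ℝ), (∀ i, IsAlgebraic ℚ (Real.exp (l i))) → LinearIndependent ℚ l → AlgebraicIndependent ℚ l

/-- item stmt-Schanuel-11768 · crux · rank 6 · open · by planner
why it might fail: it is most of Schanuel (already n = 1 contains 'log 2 and π algebraically independent' and 'e ∉ ℚ(𝓛_ℝ)‾', both open); 'independent mod 𝓛_ℝ' is undecided in examples; no transcendence method works relative to the infinitely generated base ℚ(𝓛_ℝ).
sources: Kirby2010EAEF, Waldschmidt2000, BakerTNT1975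
[crux] Schanuel relative to K₀ = ℚ(𝓛_ℝ), 𝓛_ℝ = {z ∈ ℂ : Im z = 0, e^z ∈ ℚ̄}: if x₁…xₙ ∈ ℂ are
ℚ-linearly independent modulo the ℚ-span of 𝓛_ℝ, then trdeg over K₀ of K₀(x, eˣ) is ≥ n. The
complement of the real-log sector (x = (iπ): π is transcendental over ℚ(log 2, log 3, …); x = (1): e
is); Schanuel ⇒ it (support OffRealLogSectorOfSchanuel) and RealLogSector ∧ OffRealLogSector ⇒
Schanuel (Assembly). [difficulty: open-problem] -/
@[route_item "route-Schanuel-GeodesicRealLogs", crux]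
def OffRealLogSector : Prop :=
  ∀ (n : ℕ) (x : Fin n → ℂ), LinearIndependent ℚ ((Submodule.span ℚ {z : ℂ | z.im = 0 ∧ IsAlgebraic ℚ (Complex.exp z)}).mkQ ∘ x) → (n : Cardinal) ≤ Algebra.trdeg ↥(IntermediateField.adjoin ℚ {z : ℂ | z.im = 0 ∧ IsAlgebraic ℚ (Complex.exp z)}) ↥(IntermediateField.adjoin ↥(IntermediateField.adjoin ℚ {z : ℂ | z.im = 0 ∧ IsAlgebraic ℚ (Complex.exp z)}) (Set.range x ∪ Set.range (Complex.exp ∘ x)))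

/-- item stmt-Schanuel-11769 · support · rank 9 · open · by planner
sources: arXiv:1110.0141, Roy1995
[support] RealGP3 ⇒ PDQ21 on every ℚ-isotropic class: a nontrivial rational zero (a, b, c) of X² +
DW² − CZ² (D, C > 0) has c ≠ 0; the secant parametrisation from (a/c, b/c) writes every real zero as
ν·M·(t², t, 1)ᵀ with M ∈ M₃(ℚ), det M = −4DC ≠ 0, so a zero with ℚ-independent coordinates in 𝓛_ℝ
yields the progression (ν, νt, νt²) ∈ 𝓛_ℝ³, ℚ-independent. Explicit algebra, ~300 lines.
[difficulty: provable-now] -/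
@[route_item "route-Schanuel-GeodesicRealLogs"]
def IsotropicReduction : Prop :=
  RealGP3 → ∀ (D C : ℚ), 0 < D → 0 < C → (∃ a b c : ℚ, (a ≠ 0 ∨ b ≠ 0 ∨ c ≠ 0) ∧ a ^ 2 + D * b ^ 2 = C * c ^ 2) → ∀ x : Fin 3 → ℝ, LinearIndependent ℚ x → (∀ i, IsAlgebraic ℚ (Real.exp (x i))) → x 0 ^ 2 + (D : ℝ) * x 1 ^ 2 ≠ (C : ℝ) * x 2 ^ 2

/-- item stmt-Schanuel-11770 · support · rank 9 · open · by planner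
sources: Roy1995
[support] 'no Pythagorean triple of ℚ-independent real logs of algebraic numbers' ⟺ RealGP3: (y₂ −
y₀, 2y₁, y₂ + y₀) ↔ (y₀, y₁, y₂) is an invertible rational change of variables between the cones x²
+ w² = z² and y₁² = y₀y₂ preserving 𝓛_ℝ³ and ℚ-independence. [difficulty: provable-now] -/
@[route_item "route-Schanuel-GeodesicRealLogs"]
def PythagoreanIffGP3 : Prop :=
  (∀ x : Fin 3 → ℝ, LinearIndependent ℚ x → (∀ i, IsAlgebraic ℚ (Real.exp (x i))) → x 0 ^ 2 + x 1 ^ 2 ≠ x 2 ^ 2) ↔ RealGP3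

/-- item stmt-Schanuel-11771 · support · rank 9 · open · by planner
sources: Waldschmidt2005, Lang1966
[support] no four ℚ-linearly independent logarithms of algebraic numbers in geometric progression
(card T1): with s = x₁/x₀ apply the six exponentials theorem (tree theorem
Literature.NumberTheory.Transcendental.six_exponentials_holds) to (x₀, x₀s) × (1, s, s²), whose six
exponentials are e^{x₀}, e^{x₁}, e^{x₂}, e^{x₁}, e^{x₂}, e^{x₃}; 1, s, s² are ℚ-independent because
s is transcendental (RatioTranscendental) — or directly from the independence of x. [difficulty:
provable-now] -/
@[route_item "route-Schanuel-GeodesicRealLogs"]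
def GP4 : Prop :=
  ∀ x : Fin 4 → ℂ, LinearIndependent ℚ x → (∀ i, IsAlgebraic ℚ (Complex.exp (x i))) → ¬ (x 1 ^ 2 = x 0 * x 2 ∧ x 2 ^ 2 = x 1 * x 3)

/-- item stmt-Schanuel-11772 · support · rank 9 · open · by planner
sources: Gelfond1934, Waldschmidt2000
[support] the ratio of two ℚ-independent logarithms of algebraic numbers is transcendental (so every
GP₃ of logs has transcendental ratio, card (3)(i)): Gelfond–Schneider (tree theorem
gelfond_schneider_holds) with a = e^{x₀}, b = x₁/x₀. [difficulty: provable-now] -/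
@[route_item "route-Schanuel-GeodesicRealLogs"]
def RatioTranscendental : Prop :=
  ∀ x : Fin 2 → ℂ, LinearIndependent ℚ x → (∀ i, IsAlgebraic ℚ (Complex.exp (x i))) → Transcendental ℚ (x 1 / x 0)

/-- item stmt-Schanuel-11773 · support · rank 9 · open · by planner
sources: Gelfond1934, doi:10.2307/1970790
[support] FlatLatticeLogs for CM lattices (Re τ and |τ|² rational): μ = length of (1,0) ∈ 𝓛_ℝ,
|m+nτ|² = f(m,n) a positive-definite RATIONAL binary form with f(1,0) = 1; f takes a non-square
rational value on ℤ² (a rational quadratic polynomial all of whose integer values are rational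
squares is the square of a linear one, impossible as disc f < 0), and then μ√f ∈ 𝓛_ℝ with √f real
algebraic irrational contradicts Gelfond–Schneider (gelfond_schneider_holds). [difficulty:
provable-now] -/
@[route_item "route-Schanuel-GeodesicRealLogs"]
def FlatLatticeCM : Prop :=
  ∀ (μ : ℝ) (τ : ℂ), 0 < μ → 0 < τ.im → (∃ p q : ℚ, τ.re = p ∧ Complex.normSq τ = q) → ∃ m n : ℤ, ¬ IsAlgebraic ℚ (Real.exp (μ * ‖(m : ℂ) + (n : ℂ) * τ‖))

/-- item stmt-Schanuel-11774 · support · rank 9 · open · by planner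
sources: Waldschmidt2005, arXiv:1110.0141, doi:10.2307/1970790
[support] calibration — the degree-2 cells lie inside RealLogSector: RealLogSector ⇒ PDQ21 on all
classes (X₀² + D X₁² − C X₂² is a nonzero polynomial) ∧ FlatLatticeLogs (five lengths k ∈
{(1,0),(0,1),(1,1),(1,−1),(1,2)}: if |τ| ∉ ℚ the identities P² + Q² = 2A² + 2C², R² = A² + P² − Q² +
4C² among linear forms in an algebraically independent basis force P = ±A ± C, i.e. |1+τ| = 1+|τ| or
|1−|τ||, so τ ∈ ℝ; if |τ| ∈ ℚ, Re τ ∉ ℚ the first identity alone is contradictory; if Re τ, |τ|² ∈ ℚ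
it is the CM case, where Gelfond–Schneider for real exponents follows from RealLogSector itself).
Planner's derivation in NOTES.md; ~500 lines. [difficulty: M] -/
@[route_item "route-Schanuel-GeodesicRealLogs"]
def FragmentOfRealLogSector : Prop :=
  RealLogSector → (∀ (D C : ℚ), 0 < D → 0 < C → ∀ x : Fin 3 → ℝ, LinearIndependent ℚ x → (∀ i, IsAlgebraic ℚ (Real.exp (x i))) → x 0 ^ 2 + (D : ℝ) * x 1 ^ 2 ≠ (C : ℝ) * x 2 ^ 2) ∧ FlatLatticeLogs

/-- item stmt-Schanuel-11775 · support · rank 9 · open · by planner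
sources: Roy1992, Waldschmidt2000
[support] calibration — Schanuel ⇒ RealLogSector: tree theorem
Literature.Barriers.Schanuel.algIndepLogarithms_of_schanuel (Schanuel ⇒ algebraic independence of
complex logs) transported along the injective ℚ-algebra map ℝ → ℂ (Complex.ofReal_exp,
LinearIndependent and AlgebraicIndependent.of_comp). ~100 lines. [difficulty: provable-now] -/
@[route_item "route-Schanuel-GeodesicRealLogs"]
def RealLogSectorOfSchanuel : Prop :=
  Schanuel → RealLogSector

/-- item stmt-Schanuel-11776 · support · rank 9 · open · by planner
sources: Kirby2010EAEF, Waldschmidt2000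
[support] exactness of the split — Schanuel ⇒ OffRealLogSector: a transcendence basis of K₀(x,
eˣ)/K₀ inside {x, eˣ} and the algebraicity of the 2n generators over it involve finitely many real
logarithms; take a ℚ-basis l ⊂ 𝓛_ℝ of their span; (l, x) is ℚ-independent because x is independent
mod span 𝓛_ℝ; Schanuel for (l, x), e^l algebraic and trdeg ℚ(l) ≤ |l| give trdeg_{ℚ(l)} ℚ(l)(x, eˣ)
≥ n, contradicting a smaller transcendence degree over K₀ ⊇ ℚ(l). [difficulty: provable-now] -/
@[route_item "route-Schanuel-GeodesicRealLogs"]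
def OffRealLogSectorOfSchanuel : Prop :=
  Schanuel → OffRealLogSector

/-- item stmt-Schanuel-11777 · assembly · rank 1 · open · by planner
sources: Kirby2010EAEF, Waldschmidt2000
[assembly] RealLogSector → OffRealLogSector → Schanuel (the sector split at 𝓛_ℝ: adapted GL_n(ℚ)
basis + tower law). -/
@[route_item "route-Schanuel-GeodesicRealLogs", crux]
def Assembly : Prop :=
  RealLogSector → OffRealLogSector → Schanuel

/-! D-0027 §2.1 — DECIDING THEOREM (planner-authored via `route open/edit --closes-file`; by planner-plancard-Schanuel-Schanuel-geodesic-l-d32465ca-g2-0 2026-08-15T18:42:46Z):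
its hypotheses are this route's items and its conclusion the sub-problem Statement (glue_lint), and it elaborates with this file. -/

@[closes "route-Schanuel-GeodesicRealLogs"] theorem closes (hR : RealLogSector) (hO : OffRealLogSector) (hA : Assembly) : _root_.Schanuel :=
  hA hR hO

end Summit.Schanuel.Schanuel.Theses.GeodesicRealLogs
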